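import Literature.NumberTheory.Automorphic.Liu2021.AppendixC.HeckeEndomorphismPushPull
import HarnessLib

/-!
# `[KgK] = e_K · γ · e_K`: the Hecke endomorphism from a SINGLE translate — `#(KgK/K) · (t ≫ Alb T_γ) = #(K/N) · [KgK]`

Topic `NumberTheory/Automorphic/Liu2021/AppendixC`; namespace `Literature.NumberTheory.Automorphic.Liu2021.AppendixC.Sec42Data.HeckeTranslates`
(+ one generic counting lemma in `Literature.NumberTheory.Automorphic`).  PROOF FILE (theorems only; no definition, no named fact, no instance, no
`sorry`).  Sequel of ★ (P3) `HeckeEndomorphismPushPull`.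

★ (P3) writes `[KgK] ∈ End⁰(A_K)` as `[K:N]⁻¹ · (t ≫ Σ_{γ ∈ s} Alb T_γ)` over a TRANSVERSAL `s` of `KgK/K` (`t` an Albanese trace of the
Galois level cover `X_N → X_K`, `N` normalised by `K`).  This file removes the transversal: for EVERY single `γ ∈ KgK` with `γ⁻¹Nγ ⊆ K`,
**`#(KgK/K) · (1 ⊗ (t ≫ Alb T_γ)) = #(K/N) · [KgK]`** — the finite-level form of `[KgK] = vol(K)⁻¹ · e_K ★ δ_γ ★ e_K` ([Bump1997] §4.2 Prop. 4.2.3;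
[Milne2005ShimuraVarieties] §5: a Hecke correspondence is `X_K ← X_{K ∩ γKγ⁻¹} → X_K`).  Proof: on `H¹_ét` the shadow of `t ≫ Alb T_γ` at a
`K`-fixed class `v` is `Σ_{δ ∈ K/N} δ·γ·v` (★ `toTower_dualMap_trace`, ★ `etHeckeRep_toTower`), and `δN ↦ δγK` is a `K`-equivariant map of the
transitive `K`-set `K/N` ONTO `KgK/K = K·γK` (well defined because `γ⁻¹Nγ ⊆ K`), so its fibres all have the same size and
`#(KgK/K) · Σ_{δ ∈ K/N} F(δγK) = #(K/N) · Σ_{η ∈ KgK/K} F(η)` (`ncard_orbit_smul_sum_eq_card_smul_sum`, pure counting — no Haar measure, no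
unimodularity); ℓ-adic uniqueness (★ `Sec42Data.endAlgebra_eq_of_forall_toTower_eq`) lifts the shadow identity to `End⁰(A_K)`.

* `ncard_orbit_smul_sum_eq_card_smul_sum` — the counting lemma (any group `G`, subgroups `K`, `N`, representatives `δ` of `K/N`);
* `heckeOperator_eq_of_mem_orbit`, `heckeEnd_eq_of_mem_orbit` — `[KγK] = [KgK]` for `γK ∈ K·gK` (bookkeeping);
* **`toTower_dualMap_trace_comp_albTr`** — the shadow: `#(KγK/K) · [ᵗV(t ≫ Alb T_γ) φ]_K = #ι · [KγK][φ]_K`;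
* **`ncard_smul_of_trace_comp_albTr_eq_card_smul_heckeEnd`** — `#(KγK/K) · (1 ⊗ (t ≫ Alb T_γ)) = #ι · heckeEnd K γ` in `End⁰(A_K)`.

Use (cell `hodgecm-mathlib`, D-0151, crux `HLiu418` = stmt-HodgeConjecture-24832, d6 line road (P), `stub_RosH` glue, A-plan2 (g12) steer
2026-08-30 04:56Z «no common transversal, no `hdeg`»): each TRANSPOSED entry of the push–pull word of `[KgK]` is, on the Albanese side,
`t‴ ≫ Alb T_{γ⁻¹}` for one `γ ∈ KgK` — by this file INDIVIDUALLY a rational multiple of `[Kg⁻¹K] ∈ H_K`, which is what the (L) leg needs for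
`†`-stability of the Hecke image.  COUNT-NEUTRAL capital: HC_CM is proved only modulo the 7 printed citations until rung 0 closes.

## References
* [Liu2021] Y. Liu, *Fourier–Jacobi cycles and arithmetic relative trace formula*, Camb. J. Math. 9 (2021): §4.2 (FJcycle.tex l. 2070–2074),
  p. 133 (before (D.3)).
* [Bump1997] D. Bump, *Automorphic Forms and Representations* (1997), §4.2 Prop. 4.2.3 (double cosets as unions of left cosets).
* [Milne2005ShimuraVarieties] J. S. Milne, *Introduction to Shimura varieties* (2005), §5 pp. 57–58 (Hecke correspondences).
* [MumfordAV1970] D. Mumford, *Abelian Varieties* (1970), §19 Thm. 3.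
-/

set_option autoImplicit false

noncomputable section

open CategoryTheory NumberField Function MulAction
open scoped TensorProduct

/-! ## §0 Counting: a system of representatives of `K/N` maps onto `K·γK` with uniform fibres -/

namespace Literature.NumberTheory.Automorphic

variable {G : Type*} [Group G]

/-- **Uniform-fibre counting for `δN ↦ δγK`.**  Let `K, N ≤ G`, `δ : ι → K` a system of representatives of the left cosets `K/N`
(`hsurjN`, `hinjN`), and `γ` with `γ⁻¹Nγ ⊆ K`.  Then `i ↦ δ_i γ K` maps `ι` ONTO the `K`-orbit of `γK` in `G/K`, commuting with the left
`K`-translations up to `N` (absorbed since `N` fixes `γK`), so all fibres have the same cardinality and, for any `F : G/K → V`,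
`#(K·γK) • Σ_i F(δ_i γ K) = #ι • Σ_{η ∈ K·γK} F η` — the count behind «`KγK = ⊔ δ_i γ K` with multiplicity `[K ∩ γKγ⁻¹ : N]`»
([Bump1997] §4.2, proof of Prop. 4.2.3).  No finiteness of `G`, no measure. [cite: Bump1997, §4.2 (Prop. 4.2.3, proof)] -/
theorem ncard_orbit_smul_sum_eq_card_smul_sum (K N : Subgroup G)
    {ι : Type*} [Fintype ι] (δ : ι → G) (hδ : ∀ i, δ i ∈ K)
    (hsurjN : ∀ k ∈ K, ∃ i, (δ i)⁻¹ * k ∈ N) (hinjN : ∀ i j, (δ i)⁻¹ * δ j ∈ N → i = j)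
    (γ : G) (hγ : ∀ n ∈ N, γ⁻¹ * n * γ ∈ K) (hfin : (orbit K (γ : G ⧸ K)).Finite)
    {V : Type*} [AddCommMonoid V] (F : G ⧸ K → V) :
    (orbit K (γ : G ⧸ K)).ncard • ∑ i, F ((δ i * γ : G) : G ⧸ K) = Fintype.card ι • ∑ η ∈ hfin.toFinset, F η := by
  classical
  -- the map to cosets and its values lie in the orbit
  let f : ι → G ⧸ K := fun i => ((δ i * γ : G) : G ⧸ K)
  have hfmem : ∀ i, f i ∈ orbit K (γ : G ⧸ K) := fun i => ⟨⟨δ i, hδ i⟩, rfl⟩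
  -- `n • γK = γK` for `n ∈ N`
  have hNfix : ∀ n ∈ N, ((n * γ : G) : G ⧸ K) = (γ : G ⧸ K) := by
    intro n hn'
    rw [QuotientGroup.eq]
    have : (n * γ)⁻¹ * γ = γ⁻¹ * n⁻¹ * γ := by group
    rw [this]
    exact hγ n⁻¹ (N.inv_mem hn')
  -- translating a fibre by `k ∈ K`
  have hinj : ∀ (k : G) (hk : k ∈ K) (η : G ⧸ K),
      (Finset.univ.filter fun i => f i = η).card ≤ (Finset.univ.filter fun i => f i = ((⟨k, hk⟩ : K) • η)).card := by
    intro k hk η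
    -- choice of the translated index
    have hch : ∀ i, ∃ j, (δ j)⁻¹ * (k * δ i) ∈ N := fun i => hsurjN (k * δ i) (K.mul_mem hk (hδ i))
    choose j hj using hch
    refine Finset.card_le_card_of_injOn j (fun i hi => ?_) (fun i₁ hi₁ i₂ hi₂ h => ?_)
    · rw [Finset.coe_filter, Set.mem_setOf_eq] at hi ⊢
      refine ⟨Finset.mem_univ _, ?_⟩
      obtain ⟨-, hi⟩ := hi
      -- `δ_j γ K = k δ_i γ K`
      have e1 : ((δ (j i) * γ : G) : G ⧸ K) = ((k * δ i * γ : G) : G ⧸ K) := by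
        set n := (δ (j i))⁻¹ * (k * δ i) with hn_def
        have hδj : δ (j i) = k * δ i * n⁻¹ := by rw [hn_def]; group
        rw [hδj, show k * δ i * n⁻¹ * γ = (k * δ i) * (n⁻¹ * γ) by group, show k * δ i * γ = (k * δ i) * γ by group]
        change ((k * δ i : G) : G) • ((n⁻¹ * γ : G) : G ⧸ K) = ((k * δ i : G) : G) • ((γ : G) : G ⧸ K)
        rw [hNfix n⁻¹ (N.inv_mem (hj i))]
      change ((δ (j i) * γ : G) : G ⧸ K) = (⟨k, hk⟩ : K) • η
      rw [e1, ← hi]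
      change ((k * δ i * γ : G) : G ⧸ K) = (k : G) • ((δ i * γ : G) : G ⧸ K)
      rw [mul_assoc]
      rfl
    · have h1 := hj i₁
      have h2 := hj i₂
      rw [h] at h1
      have : (δ i₁)⁻¹ * δ i₂ ∈ N := by
        have := N.mul_mem (N.inv_mem h1) h2
        simpa [mul_assoc, mul_inv_rev] using this
      exact hinjN i₁ i₂ this
  have hcard_eq : ∀ η ∈ orbit K (γ : G ⧸ K),
      (Finset.univ.filter fun i => f i = η).card = (Finset.univ.filter fun i => f i = (γ : G ⧸ K)).card := by
    intro η hη
    obtain ⟨⟨k, hk⟩, rfl⟩ := hη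
    refine le_antisymm ?_ (hinj k hk _)
    have := hinj k⁻¹ (K.inv_mem hk) ((⟨k, hk⟩ : K) • (γ : G ⧸ K))
    rwa [show ((⟨k⁻¹, K.inv_mem hk⟩ : K) • (⟨k, hk⟩ : K) • (γ : G ⧸ K)) = (γ : G ⧸ K) from by
      rw [smul_smul]; exact (congrArg (· • (γ : G ⧸ K)) (by ext; simp)).trans (one_smul K _)] at this
  -- surjectivity onto the orbit
  have hsurj : Finset.univ.image f = hfin.toFinset := by
    ext η
    simp only [Finset.mem_image, Finset.mem_univ, true_and, Set.Finite.mem_toFinset]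
    constructor
    · rintro ⟨i, rfl⟩; exact hfmem i
    · rintro ⟨⟨k, hk⟩, rfl⟩
      obtain ⟨i, hi⟩ := hsurjN k hk
      refine ⟨i, ?_⟩
      set n := (δ i)⁻¹ * k with hn_def
      have hk' : k = δ i * n := by rw [hn_def]; group
      change ((δ i * γ : G) : G ⧸ K) = (k : G) • ((γ : G) : G ⧸ K)
      rw [hk']
      change ((δ i * γ : G) : G ⧸ K) = ((δ i * n * γ : G) : G ⧸ K)
      rw [show δ i * n * γ = δ i * (n * γ) by group]
      change _ = (δ i : G) • ((n * γ : G) : G ⧸ K)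
      rw [hNfix n hi]
      rfl
  -- regroup the sum over the fibres
  set m := (Finset.univ.filter fun i => f i = (γ : G ⧸ K)).card with hm
  have hsum : ∑ i, F (f i) = m • ∑ η ∈ hfin.toFinset, F η := by
    rw [Finset.sum_comp, hsurj, Finset.smul_sum]
    refine Finset.sum_congr rfl fun η hη => ?_
    rw [hcard_eq η ((Set.Finite.mem_toFinset hfin).1 hη)]
  have hcard : Fintype.card ι = m * (orbit K (γ : G ⧸ K)).ncard := by
    rw [← Finset.card_univ, Finset.card_eq_sum_card_image f Finset.univ, hsurj, Set.ncard_eq_toFinset_card _ hfin]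
    rw [Finset.sum_congr rfl fun η hη => hcard_eq η ((Set.Finite.mem_toFinset hfin).1 hη), Finset.sum_const, smul_eq_mul,
      mul_comm]
  rw [hsum, hcard, smul_smul, mul_comm]


end Literature.NumberTheory.Automorphic

/-! ## §1 `[KγK] = [KgK]` for `γK ∈ K·gK` -/

namespace Literature.NumberTheory.Automorphic.Liu2021.AppendixC

open Literature.AlgebraicGeometry.Motives (AbelianVariety)
open Literature.AlgebraicGeometry.Motives.AbelianVariety (rationalTateModuleMap endAlgebra rationalTateAction rationalTateAction_of)

variable {F E : Type} [Field F] [NumberField F] [IsTotallyReal F] [Field E] [NumberField E] [Algebra F E]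
  [IsTotallyComplex E] [Algebra.IsQuadraticExtension F E]
variable {P5 : PropC5Data F E} {isotropicAt : ℕ → Prop}

namespace Sec42Data.HeckeTranslates

variable {C : Sec42Data P5 isotropicAt} (T : C.HeckeTranslates) (ℓ : ℕ) [Fact ℓ.Prime]

/-- The Hecke operator of ★ `Automorphic.heckeOperator` depends on `g` only through the `K`-orbit of `gK` (i.e. the double coset `KgK`).
[cite: Bump1997, §4.2 (Prop. 4.2.3)] -/
theorem heckeOperator_eq_of_mem_orbit {k' G' V : Type*} [CommRing k'] [Group G'] [AddCommGroup V] [Module k' V]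
    (ρ : Representation k' G' V) (K : Subgroup G') {γ g : G'} (hγ : (γ : G' ⧸ K) ∈ orbit K (g : G' ⧸ K)) :
    Literature.NumberTheory.Automorphic.heckeOperator ρ K γ = Literature.NumberTheory.Automorphic.heckeOperator ρ K g := by
  simp only [Literature.NumberTheory.Automorphic.heckeOperator, (MulAction.orbit_eq_iff.2 hγ)]

/-- `heckeEnd K γ = heckeEnd K g` for `γK ∈ K·gK` (the ℓ-adic shadows agree; ★ `eq_heckeEnd`). [cite: Liu2021, p. 133 (before (D.3)) and §4.2 (FJcycle.tex l. 2074)] -/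
theorem heckeEnd_eq_of_mem_orbit (hD : T.IsogenyDescent)
    (hI : ∀ ⦃K K' : C5.SmallLevel C.S.K₀⦄ (f : K' ⟶ K), Function.Injective (rationalTateModuleMap ℓ (C.Atr f)).dualMap)
    (K : C5.SmallLevel C.S.K₀) {γ g : C.G} (hγ : (γ : C.G ⧸ (K.1.1 : Subgroup C.G)) ∈ orbit K.1.1 (g : C.G ⧸ (K.1.1 : Subgroup C.G))) :
    T.heckeEnd hD K γ = T.heckeEnd hD K g :=
  T.eq_heckeEnd ℓ hD hI K g fun φ => by
    rw [T.toTower_dualMap_rationalTateAction_heckeEnd ℓ hD K γ φ, heckeOperator_eq_of_mem_orbit _ _ hγ]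

/-! ## §2 The shadow of ONE translate: `#(KγK/K) · [ᵗV(t ≫ Alb T_γ) φ]_K = #ι · [KγK][φ]_K` -/

/-- **The shadow of `t ≫ Alb T_γ` on `H¹_ét`, counted**: for an Albanese trace `t : A_K ⟶ A_N` pinned by a system of representatives `δ` of
`K/N` (`Alb_u ≫ t = Σ_i Alb T_{δ_i}`, ★ (P3) shape, here with `δ` a FULL system: `hsurjN`, `hinjN`) and ONE translate `T_γ : X_N → X_K`
(`γ⁻¹Nγ ⊆ K`), `#(K·γK) • [ᵗV_ℓ(t ≫ Alb T_γ) φ]_K = #ι • [KγK] [φ]_K`: the left side is `Σ_i δ_i·γ·[φ]_K` (★ `toTower_dualMap_trace`, ★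
`etHeckeRep_toTower`), regrouped along `δ_iN ↦ δ_iγK` by §0. [cite: Liu2021, §4.2 (FJcycle.tex l. 2070–2074)] [cite: Bump1997, §4.2 (Prop. 4.2.3)] -/
theorem toTower_dualMap_trace_comp_albTr {N K : C5.SmallLevel C.S.K₀} (h : N ≤ K) (hn : ∀ k ∈ K.1.1, C5.HeckeLE k N N)
    {ι : Type*} [Fintype ι] (δ : ι → C.G) (hδ : ∀ i, δ i ∈ K.1.1)
    (hsurjN : ∀ k ∈ K.1.1, ∃ i, (δ i)⁻¹ * k ∈ N.1.1) (hinjN : ∀ i j, (δ i)⁻¹ * δ j ∈ N.1.1 → i = j)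
    (t : C.A K ⟶ C.A N) (ht : C.Atr (homOfLE h) ≫ t = ∑ i, T.albTr (δ i) N N (hn _ (hδ i)))
    (γ : C.G) (hγ : C5.HeckeLE γ N K) (φ : C.etaleH1 ℓ K) :
    (orbit K.1.1 (γ : C.G ⧸ (K.1.1 : Subgroup C.G))).ncard •
        C.toTower ℓ K ((rationalTateModuleMap ℓ (t ≫ T.albTr γ N K hγ)).dualMap φ) =
      Fintype.card ι •
        Literature.NumberTheory.Automorphic.heckeOperator (T.etHeckeRep ℓ) (K.1.1 : Subgroup C.G) γ (C.toTower ℓ K φ) := by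
  classical
  have hfin := Sec42Data.BettiPinning.finite_orbit_level K γ
  have hfix : C.toTower ℓ K φ ∈ (T.etHeckeRep ℓ).fixedPoints (K.1.1 : Subgroup C.G) :=
    ((T.etHeckeRep ℓ).mem_fixedPoints K.1.1 (C.toTower ℓ K φ)).2 fun _ hk => T.etHeckeRep_toTower_of_mem ℓ hk φ
  -- the shadow of `t ≫ Alb T_γ` is `Σ_i δ_i · γ · v`
  have h1 : C.toTower ℓ K ((rationalTateModuleMap ℓ (t ≫ T.albTr γ N K hγ)).dualMap φ) =
      ∑ i, T.etHeckeRep ℓ (δ i * γ) (C.toTower ℓ K φ) := by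
    rw [← dualMap_rationalTateModuleMap_comp_apply, T.toTower_dualMap_trace ℓ h hn Finset.univ δ hδ t ht,
      ← T.etHeckeRep_toTower ℓ γ hγ φ]
    exact Finset.sum_congr rfl fun i _ => by rw [map_mul, Module.End.mul_apply]
  -- `ρ(x) v = ρ((xK).out) v` on the `K`-fixed `v`
  have h2 : ∀ x : C.G, T.etHeckeRep ℓ x (C.toTower ℓ K φ) =
      T.etHeckeRep ℓ ((x : C.G ⧸ (K.1.1 : Subgroup C.G))).out (C.toTower ℓ K φ) := by
    intro x
    obtain ⟨k, hk⟩ := QuotientGroup.mk_out_eq_mul (K.1.1 : Subgroup C.G) x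
    rw [hk, map_mul, Module.End.mul_apply, ((T.etHeckeRep ℓ).mem_fixedPoints K.1.1 _).1 hfix _ k.2]
  rw [h1, Finset.sum_congr rfl fun i _ => h2 (δ i * γ),
    Literature.NumberTheory.Automorphic.ncard_orbit_smul_sum_eq_card_smul_sum (K.1.1 : Subgroup C.G) (N.1.1 : Subgroup C.G) δ hδ hsurjN
      hinjN γ hγ hfin (fun η => T.etHeckeRep ℓ η.out (C.toTower ℓ K φ)),
    Literature.NumberTheory.Automorphic.heckeOperator_apply_eq_sum_out (T.etHeckeRep ℓ) (K.1.1 : Subgroup C.G) γ hfin hfix]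

/-! ## §3 In `End⁰(A_K)`: `#(KγK/K) · (1 ⊗ (t ≫ Alb T_γ)) = #ι · heckeEnd K γ` -/

/-- **`[KγK]` FROM A SINGLE TRANSLATE**: with the data of §2, `#(K·γK) • (1 ⊗ (t ≫ Alb T_γ)) = #ι • heckeEnd K γ` in `End⁰(A_K)` — the element of
`End⁰(A_K)` built from ONE Hecke translate and the trace of the normal level cover is a rational multiple of the Hecke endomorphism of its
double coset ([Bump1997] Prop. 4.2.3 / `e_K γ e_K`; [Liu2021] p. 133: the image of `C_c^∞(K\G(𝔸^∞)/K, ℚ)` in `End(A_K)_ℚ`).  Proof: ℓ-adic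
uniqueness ★ `Sec42Data.endAlgebra_eq_of_forall_toTower_eq` on §2 and ★ `toTower_dualMap_rationalTateAction_heckeEnd`.  With ★
`heckeEnd_eq_of_mem_orbit`, `heckeEnd K γ = heckeEnd K g` for every `γ ∈ KgK`. [cite: Liu2021, p. 133 (before (D.3)) and §4.2 (FJcycle.tex l. 2074)]
[cite: Bump1997, §4.2 (Prop. 4.2.3)] [cite: MumfordAV1970, §19 Thm. 3] -/
theorem ncard_smul_of_trace_comp_albTr_eq_card_smul_heckeEnd (hD : T.IsogenyDescent)
    (hI : ∀ ⦃K K' : C5.SmallLevel C.S.K₀⦄ (f : K' ⟶ K), Function.Injective (rationalTateModuleMap ℓ (C.Atr f)).dualMap)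
    {N K : C5.SmallLevel C.S.K₀} (h : N ≤ K) (hn : ∀ k ∈ K.1.1, C5.HeckeLE k N N)
    {ι : Type*} [Fintype ι] (δ : ι → C.G) (hδ : ∀ i, δ i ∈ K.1.1)
    (hsurjN : ∀ k ∈ K.1.1, ∃ i, (δ i)⁻¹ * k ∈ N.1.1) (hinjN : ∀ i j, (δ i)⁻¹ * δ j ∈ N.1.1 → i = j)
    (t : C.A K ⟶ C.A N) (ht : C.Atr (homOfLE h) ≫ t = ∑ i, T.albTr (δ i) N N (hn _ (hδ i)))
    (γ : C.G) (hγ : C5.HeckeLE γ N K) :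
    (orbit K.1.1 (γ : C.G ⧸ (K.1.1 : Subgroup C.G))).ncard • endAlgebra.of (C.A K) (t ≫ T.albTr γ N K hγ) =
      Fintype.card ι • T.heckeEnd hD K γ := by
  refine C.endAlgebra_eq_of_forall_toTower_eq ℓ hI K fun φ => ?_
  have hd : ∀ (n : ℕ) (f : (C.A K).rationalTateModule ℓ →ₗ[ℚ_[ℓ]] (C.A K).rationalTateModule ℓ) (ψ : C.etaleH1 ℓ K),
      (n • f).dualMap ψ = n • f.dualMap ψ := fun n f ψ => by
    ext v
    simp only [LinearMap.dualMap_apply, LinearMap.smul_apply, map_nsmul]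
  rw [map_nsmul, map_nsmul, rationalTateAction_of, hd, hd, map_nsmul, map_nsmul,
    T.toTower_dualMap_trace_comp_albTr ℓ h hn δ hδ hsurjN hinjN t ht γ hγ φ,
    T.toTower_dualMap_rationalTateAction_heckeEnd ℓ hD K γ φ]

end Sec42Data.HeckeTranslates

end Literature.NumberTheory.Automorphic.Liu2021.AppendixC

end
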